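import Mathlib
import Literature.NumberTheory.LFunctions.Zhang2022.Section15Step15u002
import Literature.NumberTheory.LFunctions.Zhang2022.Section2FunctionalEquation
import Literature.NumberTheory.LFunctions.Zhang2022.Section4LLStripGrowth
import Literature.NumberTheory.LFunctions.Zhang2022.TypedSection15ASubsteps
import Literature.NumberTheory.LFunctions.Zhang2022.Section13ConjugateAFE
import Literature.NumberTheory.LFunctions.Zhang2022.Section17Eq177Shift
import Literature.NumberTheory.Sieve.LargeSieveCharacters
import HarnessLib

/-!
# Zhang (2022) §15 p. 80, the LEFT contour move `𝔍(−α) → 𝔍(−1)` for `I₂⁻(ψ)`: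
# `Σ_{ψ∈Ψ₁} I₂⁻(ψ) = Σ_{ψ∈Ψ₁} (1/2πi)∫_{𝔍(−1)} 𝔨₁(s,ψ)ω(s)ds + O(ε)` — the typed node
# `Typed.Section15A.Step15_u008a`, kernel-checked from Proposition 2.2 (i)

Topic `Literature/NumberTheory/LFunctions/Zhang2022` (Landau–Siegel audit tree; verdict-neutral).
Y. Zhang, *Discrete mean estimates and the Landau–Siegel zero*, arXiv:2211.02515v1 (2022)
[Zhang2022LandauSiegel] — **an unrefereed manuscript under adjudication; nothing in this file asserts or
denies its Theorems 1–2.** ZHANG-L discharge lane, leaf `Typed.Section15A.Eq15_6 c′ bChi` (h15_6),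
node `Z22:§15.u008` first half [Z22 p.80, tex L4033]:

> "Hence, moving the segment `𝔍(−α)` to `𝔍(−1)` with a negligible error, we find that
> `Σ_{ψ∈Ψ₁} I₂⁻(ψ) = τ(χ)Σ_{ψ∈Ψ₁} … + o(𝔓)`."

The typed sub-node `Typed.Section15A.Step15_u008a c′` (`TypedSection15ASubsteps`, zl-w15-typer) is the
EXACT move for the integrand `𝔨₁(s,ψ)ω(s)` itself:
`‖Σ_{ψ∈Ψ₁} I₂⁻(ψ) − Σ_{ψ∈Ψ₁}(1/2πi)∫_{𝔍(−1)}𝔨₁ω‖ ≤ Ce^{−c𝓛¹⁰}`. This file PROVES it outright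
(`step15_u008a_holds : ∀ c′, Step15_u008a c′`), as the mirror image in `σ = ½` of the tree's §8.u016 /
§16 moves `𝔍(α) → 𝔍(1)` (`Step8u016.step8u016_of`, `Step16u010.sum_I3plus_sub_Theta2_le_of`, whose
sizes and mechanism are reused):

* `LFunction_ne_zero_left_of_onLine`, `LFunction_psiChi_ne_zero_left_of_onLine` — for `ψ ∈ Ψ₁` with
  the zeros of `L(s,ψ)L(s,ψχ)` in `Ω` on the line (Prop. 2.2 (i) at `ψ`), `L(s,ψ) ≠ 0` and
  `L(s,ψχ) ≠ 0` for `σ < ½`, `|t − 2πt₀| < 𝓛₁ + 2`, `t > 0`: inside `Ω` by Prop. 2.2 (i); for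
  `σ ≤ 0` by the functional equation (2.2) (`GammaFactor.LFunction_eq_Zfac_mul`) and non-vanishing
  on `Re ≥ 1` (Mathlib);
* `Zfac_inv_eq_Zfac_inv_one_sub` — `Z(s,θ)⁻¹ = Z(1−s,θ̄)` wherever `L(s,θ) ≠ 0` ((2.2) twice), whence
  polynomial bounds for `Z(s,χψ)⁻¹` and for `L(s,ψ)⁻¹ = Z(1−s,ψ̄)/L(1−s,ψ̄)` to the LEFT of the line
  (`StripGrowth.norm_Zfac_le`; `|L(1−s,ψ̄)| = |L(1−s̄,ψ)|` is bounded below on `Re ≥ ½+α` by the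
  tree's `DirichletDisc.exp_neg_le_norm_LFunction`, the zeros there being on the line);
  (`|B| ≤ K_B(P+1)⁴` to the left is the tree's `Eq177.norm_Bpoly_le_left`, WP16's (17.7) move);
* `differentiableOn_frakk1_omega_left` — `𝔨₁ω` is holomorphic on the closed rectangle
  `[−½, ½−α] × [2πt₀−𝓛₁, 2πt₀+𝓛₁]`;
* `norm_frakk1_omega_le_left`, `…_uniform` — on its horizontal sides `|𝔨₁ω| ≤ K·P³³·e^{3C𝓛⁹(1+9log𝓛)}
  ·e^{2−𝓛¹⁰/4}`;
* `step15_u008a_holds` — Cauchy's theorem (`Section7aStatements.norm_intJ_sub_intJ_le`) per `ψ`, summed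
  over `#Ψ₁ ≤ 𝔓 ≤ 4P²`, `ε = e^{−𝓛¹⁰/16}`.

NOTE (order of operations, recorded on the lane board): this exact move is NOT by itself the route to
`Step15_u008` — the manuscript takes the relative errors `(1+O(𝓛⁻¹²³))` of u004/u006 on `𝔍(−α)` BEFORE
moving; the present theorem is the typed node as filed, and its lemmas (left non-vanishing, left
bounds) serve the move of the u008 main term equally. Theorems only; no definitions, no named facts.
WHAT THIS IS NOT: a proof of u008/(15.4), or any claim about Theorems 1–2 of the source or about
Landau–Siegel zeros.

## References

* Y. Zhang, arXiv:2211.02515v1 (2022), §15 p. 80 (tex L4012–L4033); §2 (2.2); §8 p. 43 (the model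
  move, §8.u016). [cite: Zhang2022LandauSiegel, §15 p. 80 (u008)]
* H. L. Montgomery, R. C. Vaughan, *Multiplicative Number Theory I* (2007), Lemma 12.6, Cor. 10.10.
  [cite: MontgomeryVaughan2007, Lemma 12.6]
-/

noncomputable section

open Complex Real Set ComplexConjugate

namespace Literature.NumberTheory.LFunctions.Zhang2022.Step15u008

open Literature.NumberTheory.LFunctions.Zhang2022 Skeleton
open Literature.NumberTheory.LFunctions.Zhang2022.Typed.Section15A

/-! ## A. Non-vanishing to the left of the critical line inside the window -/

section NonVanishing

variable {D : ℕ} [NeZero D] {χ : DirichletCharacter ℂ D} (x : Chr D)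

omit [NeZero D] in
/-- The window `Ω` in coordinates. [cite: Zhang2022LandauSiegel, §2 (2.7)] -/
private theorem mem_Omega_iff' (s : ℂ) :
    s ∈ Omega D ↔ |s.re - 1 / 2| < 1 / 2 ∧ |s.im - 2 * π * t0 D| < ell1 D + 2 := by
  simp [Omega, s0, SmoothWeight.s0]

/-- **`L(s,ψ) ≠ 0` to the LEFT of the critical line inside the window**: if the zeros of
`L(s,ψ)L(s,ψχ)` in `Ω` lie on `σ = ½` (Prop. 2.2 (i) at `ψ`), then `L(s,ψ) ≠ 0` for `σ < ½`, `t > 0`,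
`|t − 2πt₀| < 𝓛₁ + 2`: for `σ > 0` the point is in `Ω`; for `σ ≤ 0` the functional equation (2.2)
`L(s,ψ) = Z(s,ψ)L(1−s,ψ̄)` with `Z(s,ψ) ≠ 0` (`Im s > 0`) and `L(1−s,ψ̄) ≠ 0` (`Re(1−s) ≥ 1`).
[cite: Zhang2022LandauSiegel, §15 p. 80; §2 (2.2)] -/
theorem LFunction_ne_zero_left_of_onLine (h22 : ∀ s ∈ prodZeroSetOmega χ x, s.re = 1 / 2) {s : ℂ}
    (hre : s.re < 1 / 2) (him0 : 0 < s.im) (him : |s.im - 2 * π * t0 D| < ell1 D + 2) :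
    x.ψ.LFunction s ≠ 0 := by
  intro h0
  rcases lt_or_ge 0 s.re with h1 | h1
  · have hΩ : s ∈ Omega D := by
      rw [mem_Omega_iff']
      refine ⟨?_, him⟩
      rw [abs_lt]; constructor <;> linarith
    have hmem : s ∈ prodZeroSetOmega χ x := ⟨hΩ, by rw [h0, zero_mul]⟩
    have := h22 s hmem
    linarith
  · have hfe := GammaFactor.LFunction_eq_Zfac_mul x.prim x.p_ne_one (s := s) him0.ne'
    have hZ : GammaFactor.Zfac x.ψ s ≠ 0 := GammaFactor.Zfac_ne_zero x.prim him0
    have hinv1 : x.ψ⁻¹ ≠ 1 := fun h => x.ψ_ne_one (inv_eq_one.mp h)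
    have hL1 : x.ψ⁻¹.LFunction (1 - s) ≠ 0 :=
      DirichletCharacter.LFunction_ne_zero_of_one_le_re x.ψ⁻¹ (Or.inl hinv1)
        (by rw [Complex.sub_re, Complex.one_re]; linarith)
    rw [hfe] at h0
    exact (mul_ne_zero hZ hL1) h0

/-- **`L(s,ψχ) ≠ 0` to the left of the critical line inside the window**, likewise (Prop. 2.2 (i) is
about the product `L(s,ψ)L(s,ψχ)`; for `σ ≤ 0` the functional equation of the primitive `ψχ (mod Dp)`,
`D ≥ 3`). [cite: Zhang2022LandauSiegel, §15 p. 80; §2 (2.2)] -/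
theorem LFunction_psiChi_ne_zero_left_of_onLine (hD : 3 ≤ D) (hχ : χ.IsPrimitive)
    (h22 : ∀ s ∈ prodZeroSetOmega χ x, s.re = 1 / 2) {s : ℂ}
    (hre : s.re < 1 / 2) (him0 : 0 < s.im) (him : |s.im - 2 * π * t0 D| < ell1 D + 2) :
    (psiChi χ x).LFunction s ≠ 0 := by
  intro h0
  rcases lt_or_ge 0 s.re with h1 | h1
  · have hΩ : s ∈ Omega D := by
      rw [mem_Omega_iff']
      refine ⟨?_, him⟩
      rw [abs_lt]; constructor <;> linarith
    have hmem : s ∈ prodZeroSetOmega χ x := ⟨hΩ, by rw [h0, mul_zero]⟩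
    have := h22 s hmem
    linarith
  · have hprim := psiChiPrimitive_holds D χ x hD hχ
    have hDp : D * x.p ≠ 1 := by
      have : 3 * 1 ≤ D * x.p := Nat.mul_le_mul hD x.prime.one_lt.le
      omega
    have hfe := GammaFactor.LFunction_eq_Zfac_mul hprim hDp (s := s) him0.ne'
    have hZ : GammaFactor.Zfac (psiChi χ x) s ≠ 0 := GammaFactor.Zfac_ne_zero hprim him0
    have hne1 : psiChi χ x ≠ 1 := psiChi_ne_one χ hD hχ x
    have hinv1 : (psiChi χ x)⁻¹ ≠ 1 := fun h => hne1 (inv_eq_one.mp h)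
    have hL1 : (psiChi χ x)⁻¹.LFunction (1 - s) ≠ 0 :=
      DirichletCharacter.LFunction_ne_zero_of_one_le_re (psiChi χ x)⁻¹ (Or.inl hinv1)
        (by rw [Complex.sub_re, Complex.one_re]; linarith)
    rw [hfe] at h0
    exact (mul_ne_zero hZ hL1) h0

end NonVanishing

/-! ## B. `Z(s,θ)⁻¹ = Z(1−s,θ̄)` off the zeros, and the sizes to the left of the line -/

section LeftSizes

/-- **`Z(s,θ)⁻¹ = Z(1−s,θ̄)`** for a primitive `θ (mod k)`, `k ≠ 1`, `Im s ≠ 0`, at any point where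
`L(s,θ) ≠ 0`: the functional equation (2.2) for `θ` at `s` and for `θ̄` at `1−s` give
`L(s,θ) = Z(s,θ)Z(1−s,θ̄)L(s,θ)`. [cite: Zhang2022LandauSiegel, §2 (2.2)] -/
theorem Zfac_inv_eq_Zfac_inv_one_sub {k : ℕ} [NeZero k] {θ : DirichletCharacter ℂ k}
    (hθ : θ.IsPrimitive) (hk : k ≠ 1) {s : ℂ} (hs : s.im ≠ 0) (hL : θ.LFunction s ≠ 0) :
    (GammaFactor.Zfac θ s)⁻¹ = GammaFactor.Zfac θ⁻¹ (1 - s) := by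
  have h1 := GammaFactor.LFunction_eq_Zfac_mul hθ hk (s := s) hs
  have hθ' : θ⁻¹.IsPrimitive := Literature.NumberTheory.Sieve.LargeSieve.isPrimitive_inv hθ
  have hs' : (1 - s).im ≠ 0 := by simpa using hs
  have h2 := GammaFactor.LFunction_eq_Zfac_mul hθ' hk (s := 1 - s) hs'
  rw [inv_inv, sub_sub_cancel] at h2
  -- `L = Z Z' L`
  have h3 : θ.LFunction s * (1 - GammaFactor.Zfac θ s * GammaFactor.Zfac θ⁻¹ (1 - s)) = 0 := by
    have : θ.LFunction s = GammaFactor.Zfac θ s * GammaFactor.Zfac θ⁻¹ (1 - s) * θ.LFunction s := by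
      conv_lhs => rw [h1, h2]
      ring
    linear_combination this
  have h4 : GammaFactor.Zfac θ s * GammaFactor.Zfac θ⁻¹ (1 - s) = 1 := by
    have := (mul_eq_zero.mp h3).resolve_left hL
    linear_combination -this
  exact inv_eq_of_mul_eq_one_right h4

variable {D : ℕ} [NeZero D] {χ : DirichletCharacter ℂ D} (x : Chr D)

/-- **`|Z(s,χψ)⁻¹| ≤ 4(Dp)³t³`** to the left of the line inside the window (`−3/2 ≤ σ < ½`,
`t ≥ 342`), for `ψ ∈ Ψ₁` under Prop. 2.2 (i): `Z(s,χψ)⁻¹ = Z(1−s, (χψ)‾)` (`L(s,χψ) ≠ 0` there) and the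
crude Stirling size `StripGrowth.norm_Zfac_le` (`A = 2`). [cite: Zhang2022LandauSiegel, §15 p. 80; §2 (2.5)] -/
theorem norm_Zpc_inv_le_left (hD : 3 ≤ D) (hχ : χ.IsPrimitive)
    (h22 : ∀ s ∈ prodZeroSetOmega χ x, s.re = 1 / 2) {s : ℂ}
    (hre1 : -1 ≤ s.re) (hre : s.re < 1 / 2) (him : |s.im - 2 * π * t0 D| < ell1 D + 2)
    (ht : 342 ≤ s.im) :
    ‖(Zpc χ x s)⁻¹‖ ≤ 4 * (((D * x.p : ℕ) : ℝ)) ^ 3 * s.im ^ 3 := by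
  have him0 : 0 < s.im := by linarith
  have hprim := psiChiPrimitive_holds D χ x hD hχ
  have hDp : D * x.p ≠ 1 := by
    have : 3 * 1 ≤ D * x.p := Nat.mul_le_mul hD x.prime.one_lt.le
    omega
  have hL := LFunction_psiChi_ne_zero_left_of_onLine x hD hχ h22 hre him0 him
  rw [Zpc, Zfac_inv_eq_Zfac_inv_one_sub hprim hDp him0.ne' hL]
  have h := StripGrowth.norm_Zfac_le (psiChi χ x)⁻¹ (A := 2) (by norm_num) (s := 1 - s)
    (by rw [Complex.sub_re, Complex.one_re, abs_le]; push_cast; constructor <;> linarith)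
    (by rw [Complex.sub_im, Complex.one_im, zero_sub, abs_neg, abs_of_pos him0]; push_cast; linarith)
  rw [Complex.sub_im, Complex.one_im, zero_sub, abs_neg, abs_of_pos him0] at h
  simpa using h

/-- **`|L(s,ψ)⁻¹| ≤ 4p³t³·exp(C(1+log(1/α))(log p + log(|t|+4)))`** on the left part of the closed
rectangle of the move (`−½ ≤ σ ≤ ½−α`, `|t − 2πt₀| ≤ 𝓛₁`, `t ≥ 342`), for `ψ ∈ Ψ₁` under Prop. 2.2 (i):
`L(s,ψ)⁻¹ = Z(1−s,ψ̄)·L(1−s,ψ̄)⁻¹` ((2.2) twice), `|Z(1−s,ψ̄)| ≤ 4p³t³`, and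
`|L(1−s,ψ̄)| = |L(1−s̄,ψ)| ≥ e^{−C(1+log(1/α))ℒ}` because `Re(1−s̄) ∈ [½+α, 3/2]` and the zeros of
`L(·,ψ)` in the Montgomery–Vaughan disc at height `t` lie on the line (`Step8u016.discZeros_re_eq_half`).
[cite: Zhang2022LandauSiegel, §15 p. 80; §2 (2.2)] [cite: MontgomeryVaughan2007, Lemma 12.6] -/
theorem norm_LFunction_inv_le_left {C : ℝ}
    (hC : ∀ (q : ℕ) [NeZero q] (θ : DirichletCharacter ℂ q), θ ≠ 1 → ∀ t σ d : ℝ,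
      1 / 2 ≤ σ → σ ≤ 2 → 0 < d → d ≤ 1 →
        (∀ ρ ∈ DirichletDisc.discZeros θ t, ∀ y ∈ Icc σ 2, d ≤ ‖(y : ℂ) + t * I - ρ‖) →
          Real.exp (-(C * (1 + Real.log (1 / d)) * (Real.log q + Real.log (|t| + 4)))) ≤
            ‖θ.LFunction ((σ : ℂ) + t * I)‖)
    (h22 : ∀ s ∈ prodZeroSetOmega χ x, s.re = 1 / 2) (hα0 : 0 < alpha D) (hα1 : alpha D ≤ 1)
    {u t : ℝ} (hu1 : -1 / 2 ≤ u) (hu2 : u ≤ 1 / 2 - alpha D) (ht : |t - 2 * π * t0 D| ≤ ell1 D)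
    (ht1 : 342 ≤ t) :
    ‖(x.ψ.LFunction ((u : ℂ) + t * I))⁻¹‖ ≤
      4 * (x.p : ℝ) ^ 3 * t ^ 3 *
        Real.exp (C * (1 + Real.log (1 / alpha D)) * (Real.log x.p + Real.log (|t| + 4))) := by
  set s : ℂ := (u : ℂ) + t * I with hs
  have hsre : s.re = u := by simp [hs]
  have hsim : s.im = t := by simp [hs]
  have ht0 : 0 < t := by linarith
  have hℓ10 : 0 ≤ ell1 D := pow_nonneg (Real.log_natCast_nonneg D) _
  have himw : |s.im - 2 * π * t0 D| < ell1 D + 2 := by rw [hsim]; linarith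
  have hL : x.ψ.LFunction s ≠ 0 :=
    LFunction_ne_zero_left_of_onLine x h22 (by rw [hsre]; linarith) (by rw [hsim]; exact ht0) himw
  -- `L(s,ψ)⁻¹ = Z(1−s,ψ̄)·L(1−s,ψ̄)⁻¹`
  have hfe := GammaFactor.LFunction_eq_Zfac_mul x.prim x.p_ne_one (s := s) (by rw [hsim]; exact ht0.ne')
  have hZinv := Zfac_inv_eq_Zfac_inv_one_sub x.prim x.p_ne_one (by rw [hsim]; exact ht0.ne') hL
  have hinv : (x.ψ.LFunction s)⁻¹ =
      GammaFactor.Zfac x.ψ⁻¹ (1 - s) * (x.ψ⁻¹.LFunction (1 - s))⁻¹ := by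
    rw [hfe, mul_inv, hZinv]
  -- `|Z(1−s,ψ̄)| ≤ 4p³t³`
  have hZ : ‖GammaFactor.Zfac x.ψ⁻¹ (1 - s)‖ ≤ 4 * (x.p : ℝ) ^ 3 * t ^ 3 := by
    have h := StripGrowth.norm_Zfac_le x.ψ⁻¹ (A := 2) (by norm_num) (s := 1 - s)
      (by rw [Complex.sub_re, Complex.one_re, hsre, abs_le]; push_cast; constructor <;> linarith)
      (by rw [Complex.sub_im, Complex.one_im, hsim, zero_sub, abs_neg, abs_of_pos ht0]; push_cast; linarith)
    rw [Complex.sub_im, Complex.one_im, hsim, zero_sub, abs_neg, abs_of_pos ht0] at h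
    simpa using h
  -- `|L(1−s,ψ̄)| = |L((1−u)+it,ψ)| ≥ e^{−C(1+log(1/α))ℒ}`
  have hconj : x.ψ⁻¹.LFunction (1 - s) = conj (x.ψ.LFunction (((1 - u : ℝ) : ℂ) + t * I)) := by
    rw [Typed.Section13.LFunction_inv_conj x (1 - s)]
    congr 2
    apply Complex.ext <;> simp [hs]
  have hdist := DirichletDisc.dist_segment_of_re_le (χ := x.ψ) (t := t) (σ := 1 - u) (d := alpha D)
    (fun ρ hρ => by rw [Step8u016.discZeros_re_eq_half h22 ht ρ hρ]; linarith)
  have hlow := hC x.p x.ψ x.ψ_ne_one t (1 - u) (alpha D) (by linarith) (by linarith) hα0 hα1 hdist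
  set E : ℝ := Real.exp (C * (1 + Real.log (1 / alpha D)) * (Real.log x.p + Real.log (|t| + 4)))
    with hE
  have hE0 : 0 < E := Real.exp_pos _
  have hLn : ‖x.ψ⁻¹.LFunction (1 - s)‖ = ‖x.ψ.LFunction (((1 - u : ℝ) : ℂ) + t * I)‖ := by
    rw [hconj, Complex.norm_conj]
  have hLs0 : 0 < ‖x.ψ⁻¹.LFunction (1 - s)‖ := by
    rw [hLn]; exact lt_of_lt_of_le (Real.exp_pos _) hlow
  have hF : ‖(x.ψ⁻¹.LFunction (1 - s))⁻¹‖ ≤ E := by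
    rw [norm_inv, inv_le_comm₀ hLs0 hE0, hE, ← Real.exp_neg, hLn]
    exact hlow
  rw [hinv, norm_mul]
  exact mul_le_mul hZ hF (norm_nonneg _) (by positivity)

end LeftSizes

/-! ## C. Holomorphy of `𝔨₁ω` on the closed left rectangle -/

section Holomorphy

variable (c' : ℝ) {D : ℕ} [NeZero D] (χ : DirichletCharacter ℂ D) (x : Chr D)

/-- **The integrand `𝔨₁(s,ψ)ω(s)` of `I₂^±` is holomorphic on the closed rectangle
`[−½, ½−α] × [2πt₀−𝓛₁, 2πt₀+𝓛₁]`** for `ψ ∈ Ψ₁` with the zeros of `L(s,ψ)L(s,ψχ)` in `Ω` on the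
line, `D ≥ 3`, `χ` primitive, `0 < α`, `𝓛₁ < 2πt₀`: `Z(s,χψ)⁻¹` is holomorphic on `Im s > 0`,
`L(·,ψ)`, `B`, `K`, `ω` are entire, and `L(s,ψ) ≠ 0` on the rectangle
(`LFunction_ne_zero_left_of_onLine`). [cite: Zhang2022LandauSiegel, §15 p. 80 (u008)] -/
theorem differentiableOn_frakk1_omega_left (hD : 3 ≤ D) (hp : χ.IsPrimitive)
    (h22 : ∀ s ∈ prodZeroSetOmega χ x, s.re = 1 / 2)
    (hα0 : 0 < alpha D) (hα1 : alpha D ≤ 1) (hwin : ell1 D < 2 * π * t0 D) :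
    DifferentiableOn ℂ (fun s => frakk1 c' χ x s * omegaW D s)
      (Set.uIcc (1 / 2 + (-1 : ℝ)) (1 / 2 + (-alpha D)) ×ℂ
        Set.uIcc (2 * π * t0 D - ell1 D) (2 * π * t0 D + ell1 D)) := by
  intro s hs
  have hre : 1 / 2 + (-1 : ℝ) ≤ s.re ∧ s.re ≤ 1 / 2 + (-alpha D) := by
    have h := hs.1
    rw [Set.uIcc_of_le (by linarith)] at h
    exact h
  have hℓ1 : 0 ≤ ell1 D := pow_nonneg (Real.log_natCast_nonneg D) _
  have him : 2 * π * t0 D - ell1 D ≤ s.im ∧ s.im ≤ 2 * π * t0 D + ell1 D := by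
    have h := hs.2
    rw [Set.uIcc_of_le (by linarith)] at h
    exact h
  have him0 : 0 < s.im := by linarith
  have himw : |s.im - 2 * π * t0 D| < ell1 D + 2 := by
    rw [abs_lt]; constructor <;> linarith
  have hL : x.ψ.LFunction s ≠ 0 :=
    LFunction_ne_zero_left_of_onLine x h22 (by linarith [hre.2]) him0 himw
  have hprim := psiChiPrimitive_holds D χ x hD hp
  have hLd := DirichletCharacter.differentiable_LFunction x.ψ_ne_one
  have hZ : DifferentiableAt ℂ (fun s => (Zpc χ x s)⁻¹) s := by
    unfold Zpc
    exact (GammaFactor.differentiableAt_Zfac (psiChi χ x) him0).inv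
      (GammaFactor.Zfac_ne_zero hprim him0)
  have hL1 : DifferentiableAt ℂ (fun s => x.ψ.LFunction (s + beta1 c' D)) s :=
    (hLd.comp (differentiable_id.add_const _)).differentiableAt
  have hL2 : DifferentiableAt ℂ (fun s => x.ψ.LFunction (s + beta2 c' D)) s :=
    (hLd.comp (differentiable_id.add_const _)).differentiableAt
  have hL0 : DifferentiableAt ℂ (fun s => x.ψ.LFunction s) s := hLd.differentiableAt
  have hB : DifferentiableAt ℂ (Bpoly χ x) s :=
    (Typed.Section17.differentiable_Bpoly χ x).differentiableAt
  have hK : DifferentiableAt ℂ (fun s => Kchar D (psiBarFn x) (1 - s - beta3 c' D)) s :=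
    ((Step16u010.differentiable_Kchar (psiBarFn x)).comp
      (((differentiable_const (1 : ℂ)).sub differentiable_id).sub_const _)).differentiableAt
  have hω : DifferentiableAt ℂ (omegaW D) s := (Section7aStatements.differentiable_omegaW D) s
  have hfun : (fun s => frakk1 c' χ x s * omegaW D s) = fun s =>
      (Zpc χ x s)⁻¹ * (x.ψ.LFunction (s + beta1 c' D) * x.ψ.LFunction (s + beta2 c' D) /
        x.ψ.LFunction s) * Bpoly χ x s * Kchar D (psiBarFn x) (1 - s - beta3 c' D) *
        omegaW D s := by
    funext s; rfl
  rw [hfun]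
  exact ((((hZ.mul ((hL1.mul hL2).div hL0 hL)).mul hB).mul hK).mul hω).differentiableWithinAt

end Holomorphy

/-! ## D. The size of `𝔨₁ω` on the horizontal sides of the left rectangle -/

section EdgeBound

variable (c' : ℝ) {D : ℕ} [NeZero D] {χ : DirichletCharacter ℂ D} (x : Chr D)

omit [NeZero D] in
/-- `t₀ ≥ 729`, `𝓛₁ ≤ t₀`, `𝓛₁ < 2πt₀`, `342 ≤ 2πt₀ − 𝓛₁` for `𝓛 ≥ 3`. [cite: Zhang2022LandauSiegel, §2 (2.8)] -/
private theorem window_sizes_left (hℓ : 3 ≤ ell D) :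
    729 ≤ t0 D ∧ ell1 D ≤ t0 D ∧ ell1 D < 2 * π * t0 D ∧ 342 ≤ 2 * π * t0 D - ell1 D ∧
      0 ≤ ell1 D := by
  have hℓ1 : 1 ≤ ell D := by linarith
  have h6 : (3 : ℝ) ^ 6 ≤ ell D ^ 6 := pow_le_pow_left₀ (by norm_num) hℓ 6
  have h6' : ell D ^ 6 ≤ ell D ^ 519 := pow_le_pow_right₀ hℓ1 (by norm_num)
  have h1 : ell D ^ 405 ≤ ell D ^ 519 := pow_le_pow_right₀ hℓ1 (by norm_num)
  rw [ell1, t0]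
  refine ⟨by nlinarith, h1, by nlinarith [Real.pi_gt_three], by nlinarith [Real.pi_gt_three],
    by positivity⟩

/-- **The integrand on the horizontal sides of the LEFT rectangle.** For `ψ ∈ Ψ₁` with the zeros of
`L(s,ψ)L(s,ψχ)` in `Ω` on the line, `D ≥ 3`, `χ` primitive, `𝓛 ≥ 3`, `α ≤ 1/6`, `|c′|α𝓛 ≤ 1`, and
`s = u + it` with `−½ ≤ u ≤ ½−α`, `|t − 2πt₀| ≤ 𝓛₁`:
`|𝔨₁(s,ψ)ω(s)| ≤ [4(Dp)³t³]·[4p³Z(t+3)³]²·[4p³t³·e^{C(1+log(1/α))(log p+log(|t|+4))}]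
 ·K_B(P+1)⁴·(2Pt₀+1)·e^{2−𝓛¹⁰/4}`, `K_B = (1+|ι₂|)(|ι₃|+|ι₄|)`, `Z = Σ(n+1)^{−5/4}`, `C` the constant
of `DirichletDisc.exp_neg_le_norm_LFunction`. [cite: Zhang2022LandauSiegel, §15 p. 80 (u008)] -/
theorem norm_frakk1_omega_le_left {C : ℝ}
    (hC : ∀ (q : ℕ) [NeZero q] (θ : DirichletCharacter ℂ q), θ ≠ 1 → ∀ t σ d : ℝ,
      1 / 2 ≤ σ → σ ≤ 2 → 0 < d → d ≤ 1 →
        (∀ ρ ∈ DirichletDisc.discZeros θ t, ∀ y ∈ Icc σ 2, d ≤ ‖(y : ℂ) + t * I - ρ‖) →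
          Real.exp (-(C * (1 + Real.log (1 / d)) * (Real.log q + Real.log (|t| + 4)))) ≤
            ‖θ.LFunction ((σ : ℂ) + t * I)‖)
    (h22 : ∀ s ∈ prodZeroSetOmega χ x, s.re = 1 / 2) (hD : 3 ≤ D) (hp : χ.IsPrimitive)
    (hℓ3 : 3 ≤ ell D) (hα0 : 0 < alpha D) (hα : alpha D ≤ 1 / 6)
    (hc : |c'| * (alpha D * ell D) ≤ 1)
    {u t : ℝ} (hu1 : -1 / 2 ≤ u) (hu2 : u ≤ 1 / 2 - alpha D)
    (ht : |t - 2 * π * t0 D| ≤ ell1 D) (ht1 : ell1 D - 1 ≤ |t - 2 * π * t0 D|) :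
    ‖frakk1 c' χ x ((u : ℂ) + t * I) * omegaW D ((u : ℂ) + t * I)‖ ≤
      (4 * (((D * x.p : ℕ) : ℝ)) ^ 3 * t ^ 3) *
        (4 * (x.p : ℝ) ^ 3 * (∑' n : ℕ, ((n + 1 : ℕ) : ℝ) ^ (-(5 / 4 : ℝ))) * (t + 3) ^ 3) ^ 2 *
        (4 * (x.p : ℝ) ^ 3 * t ^ 3 *
          Real.exp (C * (1 + Real.log (1 / alpha D)) * (Real.log x.p + Real.log (|t| + 4)))) *
        ((1 + ‖iota2‖) * (‖iota3‖ + ‖iota4‖) * (bigP D + 1) ^ 4) * (2 * bigP D * t0 D + 1) *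
        Real.exp (2 - ell D ^ 10 / 4) := by
  set s : ℂ := (u : ℂ) + t * I with hs
  have hsre : s.re = u := by simp [hs]
  have hsim : s.im = t := by simp [hs]
  obtain ⟨ht0729, hℓ1t0, hwin, h342, hℓ10⟩ := window_sizes_left hℓ3
  have ht342 : 342 ≤ t := by have := (abs_le.mp ht).1; linarith
  have ht0 : 0 < t := by linarith
  have hp0 : (0 : ℝ) < x.p := by exact_mod_cast x.prime.pos
  have hℓ : 1 ≤ ell D := by linarith
  have hℓ0 : 0 < ell D := by linarith
  have hℓ2 : 2 ≤ Real.log D := by rw [← ell]; linarith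
  have hα1 : alpha D ≤ 1 := by linarith
  obtain ⟨hb1, hb2, -⟩ := Step8u016.abs_b_le_one c' hα0.le hα hc
  obtain ⟨e1, e2, e3⟩ := Section8aStatements.beta_eq_b_mul_I c' D
  set Z : ℝ := ∑' n : ℕ, ((n + 1 : ℕ) : ℝ) ^ (-(5 / 4 : ℝ)) with hZ
  have hZ0 : 0 ≤ Z := tsum_nonneg fun n => by positivity
  have himw : |s.im - 2 * π * t0 D| < ell1 D + 2 := by rw [hsim]; linarith
  -- factor 1: `Z(s,χψ)⁻¹`
  have hF1 : ‖(Zpc χ x s)⁻¹‖ ≤ 4 * (((D * x.p : ℕ) : ℝ)) ^ 3 * t ^ 3 := by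
    have h := norm_Zpc_inv_le_left x hD hp h22 (s := s) (by rw [hsre]; linarith)
      (by rw [hsre]; linarith) himw (by rw [hsim]; exact ht342)
    rw [hsim] at h; exact h
  -- factors 2, 3: `L(s+β₁,ψ)`, `L(s+β₂,ψ)`
  have hLshift : ∀ b : ℝ, |b| ≤ 1 →
      ‖x.ψ.LFunction (s + (b : ℂ) * I)‖ ≤ 4 * (x.p : ℝ) ^ 3 * Z * (t + 3) ^ 3 := by
    intro b hb
    obtain ⟨hb1', hb2'⟩ := abs_le.mp hb
    have hre' : (s + (b : ℂ) * I).re = u := by simp [hs]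
    have him' : (s + (b : ℂ) * I).im = t + b := by simp [hs]
    have h := StripGrowth.norm_LFunction_le_of_abs_re_le x.prim x.p_ne_one (A := 1) le_rfl
      (s := s + (b : ℂ) * I) (by rw [hre', Nat.cast_one, abs_le]; constructor <;> linarith)
      (by rw [him', Nat.cast_one, abs_of_pos (by linarith)]; norm_num; linarith)
    rw [him', Nat.cast_one, abs_of_pos (by linarith)] at h
    have hle : t + b + 1 + 1 ≤ t + 3 := by linarith
    have hpow : (t + b + 1 + 1) ^ 3 ≤ (t + 3) ^ 3 := pow_le_pow_left₀ (by linarith) hle 3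
    calc ‖x.ψ.LFunction (s + (b : ℂ) * I)‖
        ≤ 4 * (x.p : ℝ) ^ (1 + 2) * Z * (t + b + 1 + 1) ^ (1 + 2) := h
      _ ≤ 4 * (x.p : ℝ) ^ 3 * Z * (t + 3) ^ 3 := by
          rw [show (1 : ℕ) + 2 = 3 from rfl]
          exact mul_le_mul_of_nonneg_left hpow (by positivity)
  have hF2 : ‖x.ψ.LFunction (s + beta1 c' D)‖ ≤ 4 * (x.p : ℝ) ^ 3 * Z * (t + 3) ^ 3 := by
    rw [e1]; exact hLshift _ hb1
  have hF3 : ‖x.ψ.LFunction (s + beta2 c' D)‖ ≤ 4 * (x.p : ℝ) ^ 3 * Z * (t + 3) ^ 3 := by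
    rw [e2]; exact hLshift _ hb2
  -- factor 4: `L(s,ψ)⁻¹`
  set E : ℝ := Real.exp (C * (1 + Real.log (1 / alpha D)) * (Real.log x.p + Real.log (|t| + 4)))
    with hE
  have hF4 : ‖(x.ψ.LFunction s)⁻¹‖ ≤ 4 * (x.p : ℝ) ^ 3 * t ^ 3 * E :=
    norm_LFunction_inv_le_left x hC h22 hα0 hα1 hu1 hu2 ht ht342
  -- factor 5: `B(s,ψ)`
  set KB : ℝ := (1 + ‖iota2‖) * (‖iota3‖ + ‖iota4‖) with hKB
  have hKB0 : 0 ≤ KB := by rw [hKB]; positivity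
  have hF5 : ‖Bpoly χ x s‖ ≤ KB * (bigP D + 1) ^ 4 :=
    Eq177.norm_Bpoly_le_left χ x hℓ2 (by rw [hsre]; linarith)
  -- factor 6: `K(1−s−β₃,ψ̄)`
  have hF6 : ‖Kchar D (psiBarFn x) (1 - s - beta3 c' D)‖ ≤ 2 * bigP D * t0 D + 1 := by
    refine norm_Kchar_psiBar_le x hℓ0 ?_
    have hre3 : (1 - s - beta3 c' D).re = 1 - u := by
      rw [e3]; simp [hs]
    rw [hre3]; linarith
  -- factor 7: the weight
  have hF7 : ‖omegaW D s‖ ≤ Real.exp (2 - ell D ^ 10 / 4) :=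
    Section8aStatements.norm_omegaW_le_exp (by linarith) (by rw [hsre, abs_le]; constructor <;> linarith)
      (by rw [hsim]; exact ht1)
  -- assembly
  have hfun : frakk1 c' χ x s * omegaW D s = (Zpc χ x s)⁻¹ *
      (x.ψ.LFunction (s + beta1 c' D) * x.ψ.LFunction (s + beta2 c' D) * (x.ψ.LFunction s)⁻¹) *
      Bpoly χ x s * Kchar D (psiBarFn x) (1 - s - beta3 c' D) * omegaW D s := by
    rw [frakk1, div_eq_mul_inv]
  rw [hfun, norm_mul, norm_mul, norm_mul, norm_mul, norm_mul, norm_mul]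
  have hP0 : 0 ≤ bigP D := (Real.exp_pos _).le
  have n1 : 0 ≤ 4 * (((D * x.p : ℕ) : ℝ)) ^ 3 * t ^ 3 := by positivity
  have n23 : 0 ≤ 4 * (x.p : ℝ) ^ 3 * Z * (t + 3) ^ 3 := by positivity
  have hE0 : 0 < E := Real.exp_pos _
  have n4 : 0 ≤ 4 * (x.p : ℝ) ^ 3 * t ^ 3 * E := by positivity
  have hLLL : ‖x.ψ.LFunction (s + beta1 c' D)‖ * ‖x.ψ.LFunction (s + beta2 c' D)‖ *
      ‖(x.ψ.LFunction s)⁻¹‖ ≤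
      (4 * (x.p : ℝ) ^ 3 * Z * (t + 3) ^ 3) ^ 2 * (4 * (x.p : ℝ) ^ 3 * t ^ 3 * E) := by
    have g := mul_le_mul hF2 hF3 (norm_nonneg _) n23
    have g2 := mul_le_mul g hF4 (norm_nonneg _) (mul_nonneg n23 n23)
    refine g2.trans (le_of_eq ?_); ring
  have n234 : 0 ≤ (4 * (x.p : ℝ) ^ 3 * Z * (t + 3) ^ 3) ^ 2 * (4 * (x.p : ℝ) ^ 3 * t ^ 3 * E) :=
    mul_nonneg (sq_nonneg _) n4
  have n5 : 0 ≤ KB * (bigP D + 1) ^ 4 := mul_nonneg hKB0 (pow_nonneg (by linarith) _)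
  have ht00 : 0 ≤ t0 D := by linarith
  have n6 : 0 ≤ 2 * bigP D * t0 D + 1 :=
    add_nonneg (mul_nonneg (mul_nonneg (by norm_num) hP0) ht00) zero_le_one
  have nLLL : 0 ≤ ‖x.ψ.LFunction (s + beta1 c' D)‖ * ‖x.ψ.LFunction (s + beta2 c' D)‖ *
      ‖(x.ψ.LFunction s)⁻¹‖ := by positivity
  have g1 := mul_le_mul hF1 hLLL nLLL n1
  have g2 := mul_le_mul g1 hF5 (norm_nonneg _) (mul_nonneg n1 n234)
  have g3 := mul_le_mul g2 hF6 (norm_nonneg _) (mul_nonneg (mul_nonneg n1 n234) n5)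
  have g4 := mul_le_mul g3 hF7 (norm_nonneg _) (mul_nonneg (mul_nonneg (mul_nonneg n1 n234) n5) n6)
  refine g4.trans (le_of_eq ?_)
  rw [hKB]; ring

/-- The growth threshold (copy of `Step8u016.growth_le` with the polynomial exponent as a parameter):
for `K₀ ≥ 0`, `L ≥ 1` with `8(K₀ + 57C) ≤ √L`, `(K₀ + 3C)L⁹ + 27C·L⁹·log L ≤ L¹⁰/8`.
[cite: Zhang2022LandauSiegel, §8 p.43 («O(ε)», `ε = e^{−c𝓛¹⁰}`)] -/
theorem growth_le_left {C L K₀ : ℝ} (hC : 0 ≤ C) (hK : 0 ≤ K₀) (hL : 1 ≤ L)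
    (hA : 8 * (K₀ + 57 * C) ≤ Real.sqrt L) :
    (K₀ + 3 * C) * L ^ 9 + 27 * C * L ^ 9 * Real.log L ≤ L ^ 10 / 8 := by
  have hL0 : 0 < L := by linarith
  have hsq : Real.sqrt L * Real.sqrt L = L := Real.mul_self_sqrt hL0.le
  have hs1 : 1 ≤ Real.sqrt L := by rw [← Real.sqrt_one]; exact Real.sqrt_le_sqrt hL
  have hlog : Real.log L ≤ 2 * Real.sqrt L := by
    have h := Real.log_le_rpow_div hL0.le (show (0:ℝ) < 1/2 by norm_num)
    rw [← Real.sqrt_eq_rpow] at h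
    linarith
  have h9 : 0 < L ^ 9 := pow_pos hL0 9
  have h1 : (K₀ + 3 * C) * L ^ 9 + 27 * C * L ^ 9 * Real.log L ≤
      (K₀ + 57 * C) * (L ^ 9 * Real.sqrt L) := by
    have ha : (K₀ + 3 * C) * L ^ 9 ≤ (K₀ + 3 * C) * (L ^ 9 * Real.sqrt L) := by
      apply mul_le_mul_of_nonneg_left _ (by positivity)
      calc L ^ 9 = L ^ 9 * 1 := (mul_one _).symm
        _ ≤ L ^ 9 * Real.sqrt L := mul_le_mul_of_nonneg_left hs1 h9.le
    have hb : 27 * C * L ^ 9 * Real.log L ≤ 54 * C * (L ^ 9 * Real.sqrt L) := by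
      calc 27 * C * L ^ 9 * Real.log L ≤ 27 * C * L ^ 9 * (2 * Real.sqrt L) :=
            mul_le_mul_of_nonneg_left hlog (by positivity)
        _ = 54 * C * (L ^ 9 * Real.sqrt L) := by ring
    nlinarith
  have h2 : (K₀ + 57 * C) * (L ^ 9 * Real.sqrt L) ≤ L ^ 10 / 8 := by
    have h3 : 8 * (K₀ + 57 * C) * Real.sqrt L ≤ Real.sqrt L * Real.sqrt L :=
      mul_le_mul_of_nonneg_right hA (by positivity)
    rw [hsq] at h3
    have : L ^ 10 / 8 = (L / 8) * L ^ 9 := by ring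
    rw [this]
    nlinarith
  linarith

set_option maxHeartbeats 800000 in
/-- **The integrand on either horizontal side of the left rectangle, uniformly in `ψ` and `u`**: with
the hypotheses of `norm_frakk1_omega_le_left`, `𝓛 ≥ 3` and `π|c′| ≤ 𝓛⁸`, on `s = u + i(2πt₀ ± 𝓛₁)`,
`−½ ≤ u ≤ ½−α`: `|𝔨₁(s,ψ)ω(s)| ≤ K·P³³·exp(3C𝓛⁹(1+9log𝓛))·e^{2−𝓛¹⁰/4}` with the absolute
`K = 4·27·512·(4·27·Z·11³)²·(4·27·512)·K_B·16·3`. [cite: Zhang2022LandauSiegel, §15 p. 80 (u008)] -/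
theorem norm_frakk1_omega_le_left_uniform {C : ℝ} (hC0 : 0 < C)
    (hC : ∀ (q : ℕ) [NeZero q] (θ : DirichletCharacter ℂ q), θ ≠ 1 → ∀ t σ d : ℝ,
      1 / 2 ≤ σ → σ ≤ 2 → 0 < d → d ≤ 1 →
        (∀ ρ ∈ DirichletDisc.discZeros θ t, ∀ y ∈ Icc σ 2, d ≤ ‖(y : ℂ) + t * I - ρ‖) →
          Real.exp (-(C * (1 + Real.log (1 / d)) * (Real.log q + Real.log (|t| + 4)))) ≤
            ‖θ.LFunction ((σ : ℂ) + t * I)‖)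
    (x : Chr D) (h22 : ∀ s ∈ prodZeroSetOmega χ x, s.re = 1 / 2) (hD : 3 ≤ D) (hp : χ.IsPrimitive)
    (hℓ : 3 ≤ ell D) (hc : π * |c'| ≤ ell D ^ 8)
    {u : ℝ} (hu1 : -1 / 2 ≤ u) (hu2 : u ≤ 1 / 2 - alpha D) {t : ℝ}
    (ht : t = 2 * π * t0 D + ell1 D ∨ t = 2 * π * t0 D - ell1 D) :
    ‖frakk1 c' χ x ((u : ℂ) + t * I) * omegaW D ((u : ℂ) + t * I)‖ ≤
      ((4 * 27 * 512) * (4 * 27 * (∑' n : ℕ, ((n + 1 : ℕ) : ℝ) ^ (-(5 / 4 : ℝ))) * 11 ^ 3) ^ 2 *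
          (4 * 27 * 512) * ((1 + ‖iota2‖) * (‖iota3‖ + ‖iota4‖)) * 16 * 3) *
        bigP D ^ 33 * Real.exp (3 * C * ell D ^ 9 * (1 + 9 * Real.log (ell D))) *
        Real.exp (2 - ell D ^ 10 / 4) := by
  obtain ⟨hα0, hα6, hα1⟩ := Step8u016.alpha_small hℓ
  obtain ⟨ht0729, hℓ1t0, hwin, h342, hℓ10⟩ := window_sizes_left hℓ
  have hcα := Step8u016.abs_c_mul_alpha_ell_le_one hℓ hc
  have hπ3 := Real.pi_gt_three
  have hπt : π * t0 D ≤ 7 / 2 * t0 D :=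
    mul_le_mul_of_nonneg_right (by linarith [Real.pi_lt_d2]) (by linarith)
  have htabs : |t - 2 * π * t0 D| ≤ ell1 D := by
    rcases ht with ht' | ht'
    · rw [ht', show 2 * π * t0 D + ell1 D - 2 * π * t0 D = ell1 D by ring, abs_of_nonneg hℓ10]
    · rw [ht', show 2 * π * t0 D - ell1 D - 2 * π * t0 D = -ell1 D by ring, abs_neg,
        abs_of_nonneg hℓ10]
  have htabs1 : ell1 D - 1 ≤ |t - 2 * π * t0 D| := by
    rcases ht with ht' | ht'
    · rw [ht', show 2 * π * t0 D + ell1 D - 2 * π * t0 D = ell1 D by ring, abs_of_nonneg hℓ10]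
      linarith
    · rw [ht', show 2 * π * t0 D - ell1 D - 2 * π * t0 D = -ell1 D by ring, abs_neg,
        abs_of_nonneg hℓ10]
      linarith
  have ht1 : 342 ≤ t := by rcases ht with ht' | ht' <;> rw [ht'] <;> linarith
  have ht0 : 0 < t := by linarith
  have htle : t ≤ 8 * t0 D := by rcases ht with ht' | ht' <;> rw [ht'] <;> linarith
  -- sizes
  have hP0 : 0 < bigP D := Real.exp_pos _
  have hP1 : 1 ≤ bigP D := Real.one_le_exp (pow_nonneg (Real.log_natCast_nonneg D) 9)
  have hp3 := Step8u016.chr_p_le_three_bigP hℓ x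
  have hp1 : (1 : ℝ) ≤ x.p := by exact_mod_cast x.prime.one_lt.le
  have hp0 : (0 : ℝ) ≤ x.p := by linarith
  have ht0P := Step8u016.t0_le_bigP hℓ
  have hDP := Step16u010.natCast_le_bigP (D := D) hD
  have hD0 : (0 : ℝ) ≤ D := Nat.cast_nonneg _
  set Z : ℝ := ∑' n : ℕ, ((n + 1 : ℕ) : ℝ) ^ (-(5 / 4 : ℝ)) with hZ
  have hZ0 : 0 ≤ Z := tsum_nonneg fun n => by positivity
  set KB : ℝ := (1 + ‖iota2‖) * (‖iota3‖ + ‖iota4‖) with hKB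
  have hKB0 : 0 ≤ KB := by rw [hKB]; positivity
  have ht8P : t ≤ 8 * bigP D := by linarith
  have ht4 : |t| + 4 ≤ 12 * bigP D := by rw [abs_of_pos ht0]; linarith
  -- factor 1: `4(Dp)³t³ ≤ 4·(3P²)³(8P)³ = 4·27·512·P⁹`
  have hDp : (((D * x.p : ℕ) : ℝ)) ≤ 3 * bigP D ^ 2 := by
    push_cast
    calc (D : ℝ) * x.p ≤ bigP D * (3 * bigP D) := mul_le_mul hDP hp3 hp0 hP0.le
      _ = 3 * bigP D ^ 2 := by ring
  have f1 : 4 * (((D * x.p : ℕ) : ℝ)) ^ 3 * t ^ 3 ≤ (4 * 27 * 512) * bigP D ^ 9 := by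
    have a : (((D * x.p : ℕ) : ℝ)) ^ 3 ≤ (3 * bigP D ^ 2) ^ 3 :=
      pow_le_pow_left₀ (Nat.cast_nonneg _) hDp 3
    have b : t ^ 3 ≤ (8 * bigP D) ^ 3 := pow_le_pow_left₀ ht0.le ht8P 3
    calc 4 * (((D * x.p : ℕ) : ℝ)) ^ 3 * t ^ 3 ≤ 4 * (3 * bigP D ^ 2) ^ 3 * (8 * bigP D) ^ 3 := by
          gcongr
      _ = (4 * 27 * 512) * bigP D ^ 9 := by ring
  -- factor 2: `(4p³Z(t+3)³)² ≤ (4·27P³·Z·(11P)³)² = (4·27·Z·1331)²·P¹²`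
  have f2 : (4 * (x.p : ℝ) ^ 3 * Z * (t + 3) ^ 3) ^ 2 ≤
      (4 * 27 * Z * 11 ^ 3) ^ 2 * bigP D ^ 12 := by
    have a : (x.p : ℝ) ^ 3 ≤ (3 * bigP D) ^ 3 := pow_le_pow_left₀ hp0 hp3 3
    have b : (t + 3) ^ 3 ≤ (11 * bigP D) ^ 3 := pow_le_pow_left₀ (by linarith) (by linarith) 3
    calc (4 * (x.p : ℝ) ^ 3 * Z * (t + 3) ^ 3) ^ 2
        ≤ (4 * (3 * bigP D) ^ 3 * Z * (11 * bigP D) ^ 3) ^ 2 := by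
          apply pow_le_pow_left₀ (by positivity); gcongr
      _ = (4 * 27 * Z * 11 ^ 3) ^ 2 * bigP D ^ 12 := by ring
  -- factor 3: `4p³t³ ≤ 4·27·512·P⁶` and the exponent
  have f3a : 4 * (x.p : ℝ) ^ 3 * t ^ 3 ≤ (4 * 27 * 512) * bigP D ^ 6 := by
    have a : (x.p : ℝ) ^ 3 ≤ (3 * bigP D) ^ 3 := pow_le_pow_left₀ hp0 hp3 3
    have b : t ^ 3 ≤ (8 * bigP D) ^ 3 := pow_le_pow_left₀ ht0.le ht8P 3
    calc 4 * (x.p : ℝ) ^ 3 * t ^ 3 ≤ 4 * (3 * bigP D) ^ 3 * (8 * bigP D) ^ 3 := by gcongr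
      _ = (4 * 27 * 512) * bigP D ^ 6 := by ring
  have f3b : Real.exp (C * (1 + Real.log (1 / alpha D)) * (Real.log x.p + Real.log (|t| + 4))) ≤
      Real.exp (3 * C * ell D ^ 9 * (1 + 9 * Real.log (ell D))) := by
    rw [Real.exp_le_exp, mul_assoc]
    have h := Step8u016.log_factor_le hℓ hp1 hp3 ht4
    calc C * ((1 + Real.log (1 / alpha D)) * (Real.log x.p + Real.log (|t| + 4)))
        ≤ C * ((1 + 9 * Real.log (ell D)) * (3 * ell D ^ 9)) := mul_le_mul_of_nonneg_left h hC0.le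
      _ = 3 * C * ell D ^ 9 * (1 + 9 * Real.log (ell D)) := by ring
  have f3 : 4 * (x.p : ℝ) ^ 3 * t ^ 3 *
      Real.exp (C * (1 + Real.log (1 / alpha D)) * (Real.log x.p + Real.log (|t| + 4))) ≤
      (4 * 27 * 512) * bigP D ^ 6 * Real.exp (3 * C * ell D ^ 9 * (1 + 9 * Real.log (ell D))) :=
    mul_le_mul f3a f3b (Real.exp_pos _).le (by positivity)
  -- factor 4: `K_B(P+1)⁴ ≤ K_B·16·P⁴`
  have f4 : KB * (bigP D + 1) ^ 4 ≤ KB * 16 * bigP D ^ 4 := by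
    have a : (bigP D + 1) ^ 4 ≤ (2 * bigP D) ^ 4 := pow_le_pow_left₀ (by linarith) (by linarith) 4
    calc KB * (bigP D + 1) ^ 4 ≤ KB * (2 * bigP D) ^ 4 := mul_le_mul_of_nonneg_left a hKB0
      _ = KB * 16 * bigP D ^ 4 := by ring
  -- factor 5: `2Pt₀ + 1 ≤ 3P²`
  have f5 : 2 * bigP D * t0 D + 1 ≤ 3 * bigP D ^ 2 := by
    have hPP : bigP D * t0 D ≤ bigP D ^ 2 := by
      rw [sq]; exact mul_le_mul_of_nonneg_left ht0P hP0.le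
    have h1 : (1 : ℝ) ≤ bigP D ^ 2 := one_le_pow₀ hP1
    linarith
  -- combine
  have hbase := norm_frakk1_omega_le_left c' x hC h22 hD hp hℓ hα0 hα6 hcα hu1 hu2 htabs htabs1
  refine hbase.trans ?_
  have n1 : 0 ≤ 4 * (((D * x.p : ℕ) : ℝ)) ^ 3 * t ^ 3 := by positivity
  have n2 : 0 ≤ (4 * (x.p : ℝ) ^ 3 * Z * (t + 3) ^ 3) ^ 2 := sq_nonneg _
  have n3 : 0 ≤ 4 * (x.p : ℝ) ^ 3 * t ^ 3 *
      Real.exp (C * (1 + Real.log (1 / alpha D)) * (Real.log x.p + Real.log (|t| + 4))) := by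
    positivity
  have n4 : 0 ≤ KB * (bigP D + 1) ^ 4 := by positivity
  have n5 : 0 ≤ 2 * bigP D * t0 D + 1 := by positivity
  have g1 := mul_le_mul f1 f2 n2 (by positivity)
  have g2 := mul_le_mul g1 f3 n3 (by positivity)
  have g3 := mul_le_mul g2 f4 n4 (by positivity)
  have g4 := mul_le_mul g3 f5 n5 (by positivity)
  have g5 := mul_le_mul_of_nonneg_right g4 (Real.exp_pos (2 - ell D ^ 10 / 4)).le
  refine g5.trans (le_of_eq ?_)
  rw [hKB]; ring

end EdgeBound

/-! ## E. `Z22:§15.u008` first half (`Step15_u008a`) from Proposition 2.2 (i) -/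

set_option maxHeartbeats 400000 in
/-- **`Typed.Section15A.Step15_u008a` as an edge from Proposition 2.2 (i)**: if for `ψ ∈ Ψ₁` the zeros
of `L(s,ψ)L(s,ψχ)` in `Ω` lie on the critical line (`Skeleton.Prop22i`), then for every `c′`, "moving
the segment `𝔍(−α)` to `𝔍(−1)`" costs `O(ε)`:
`‖Σ_{ψ∈Ψ₁} I₂⁻(ψ) − Σ_{ψ∈Ψ₁}(1/2πi)∫_{𝔍(−1)}𝔨₁ω‖ ≤ 1·e^{−𝓛¹⁰/16}` for all large `D`. Per `ψ`,
Cauchy's theorem on `[−½, ½−α]×[2πt₀−𝓛₁, 2πt₀+𝓛₁]` (`Section7aStatements.norm_intJ_sub_intJ_le`,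
holomorphy `differentiableOn_frakk1_omega_left`) leaves the two horizontal sides, each
`≤ K·P³³·e^{3C𝓛⁹(1+9log𝓛)}e^{2−𝓛¹⁰/4}` pointwise (`norm_frakk1_omega_le_left_uniform`); summing over
`#Ψ₁ ≤ 𝔓 ≤ 4P²` characters and absorbing `P³⁵ = e^{35𝓛⁹}`, `e^{O(𝓛⁹log𝓛)}` and the constants into
`e^{3𝓛¹⁰/16}` (`growth_le_left`) gives `e^{−𝓛¹⁰/16}`. [cite: Zhang2022LandauSiegel, §15 p. 80 (u008), tex L4033] -/
theorem step15_u008a_of_prop22i (h22 : Prop22i) (c' : ℝ) : Step15_u008a c' := by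
  classical
  obtain ⟨C, hC0, hC⟩ := DirichletDisc.exp_neg_le_norm_LFunction
  obtain ⟨D₁, h22'⟩ := h22
  obtain ⟨D₂, hfrakP⟩ := Step8u016.frakP_le_eventually
  set K : ℝ := (4 * 27 * 512) * (4 * 27 * (∑' n : ℕ, ((n + 1 : ℕ) : ℝ) ^ (-(5 / 4 : ℝ))) * 11 ^ 3) ^ 2 *
      (4 * 27 * 512) * ((1 + ‖iota2‖) * (‖iota3‖ + ‖iota4‖)) * 16 * 3 with hK
  have hK0 : 0 ≤ K := by
    have hZ0 : 0 ≤ ∑' n : ℕ, ((n + 1 : ℕ) : ℝ) ^ (-(5 / 4 : ℝ)) := tsum_nonneg fun n => by positivity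
    have hι : 0 ≤ (1 + ‖iota2‖) * (‖iota3‖ + ‖iota4‖) := by positivity
    rw [hK]
    exact mul_nonneg (mul_nonneg (mul_nonneg (mul_nonneg (by positivity) (by norm_num)) hι)
      (by norm_num)) (by norm_num)
  set L₀ : ℝ := max 3 (max (π * |c'| + 1) (max (4 * K + 3) ((8 * (38 + 57 * C)) ^ 2))) with hL₀
  refine ⟨1 / 16, by norm_num, 1, max (max D₁ D₂) (max ⌈Real.exp L₀⌉₊ 3), fun D _ χ hD hq hp hA => ?_⟩
  have hD₁ : D₁ ≤ D := le_trans (le_trans (le_max_left _ _) (le_max_left _ _)) hD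
  have hD₂ : D₂ ≤ D := le_trans (le_trans (le_max_right _ _) (le_max_left _ _)) hD
  have hDℓ : ⌈Real.exp L₀⌉₊ ≤ D := le_trans (le_trans (le_max_left _ _) (le_max_right _ _)) hD
  have hD3 : 3 ≤ D := le_trans (le_trans (le_max_right _ _) (le_max_right _ _)) hD
  have hM : L₀ ≤ ell D := Section4.le_ell_of_ceil_exp_le hDℓ
  have hℓ3 : 3 ≤ ell D := le_trans (le_max_left _ _) hM
  have hℓc : π * |c'| + 1 ≤ ell D := le_trans (le_trans (le_max_left _ _) (le_max_right _ _)) hM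
  have hℓK : 4 * K + 3 ≤ ell D :=
    le_trans (le_trans (le_trans (le_max_left _ _) (le_max_right _ _)) (le_max_right _ _)) hM
  have hℓA : (8 * (38 + 57 * C)) ^ 2 ≤ ell D :=
    le_trans (le_trans (le_trans (le_max_right _ _) (le_max_right _ _)) (le_max_right _ _)) hM
  have hℓ1 : 1 ≤ ell D := by linarith
  have hℓ0 : 0 < ell D := by linarith
  have h22D := h22' D χ hD₁ hq hp
  obtain ⟨hα0, hα6, hα1⟩ := Step8u016.alpha_small hℓ3
  obtain ⟨-, -, hwin, -, hℓ10⟩ := window_sizes_left hℓ3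
  have hc8 : π * |c'| ≤ ell D ^ 8 := by
    have : ell D ≤ ell D ^ 8 := by
      calc ell D = ell D ^ 1 := (pow_one _).symm
        _ ≤ ell D ^ 8 := pow_le_pow_right₀ hℓ1 (by norm_num)
    linarith
  -- the uniform side bound
  set Mval : ℝ := K * bigP D ^ 33 * Real.exp (3 * C * ell D ^ 9 * (1 + 9 * Real.log (ell D))) *
    Real.exp (2 - ell D ^ 10 / 4) with hMval
  have hMval0 : 0 ≤ Mval := by
    rw [hMval]
    exact mul_nonneg (mul_nonneg (mul_nonneg hK0 (pow_nonneg (Real.exp_pos _).le _))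
      (Real.exp_pos _).le) (Real.exp_pos _).le
  -- per character
  have hper : ∀ x ∈ finsetOf (PsiOne χ),
      ‖I2pm c' χ x (-alpha D) - I2pm c' χ x (-1)‖ ≤ Mval := by
    intro x hx
    have hx' : x ∈ PsiOne χ := mem_of_mem_finsetOf hx
    have h22x : ∀ s ∈ prodZeroSetOmega χ x, s.re = 1 / 2 := h22D x hx'
    have hF := differentiableOn_frakk1_omega_left c' χ x hD3 hp h22x hα0 hα1 hwin
    have hside : ∀ t : ℝ, (t = 2 * π * t0 D + ell1 D ∨ t = 2 * π * t0 D - ell1 D) →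
        ∀ u ∈ Set.Icc (1 / 2 + (-1 : ℝ)) (1 / 2 + (-alpha D)),
          ‖frakk1 c' χ x ((u : ℂ) + ((t : ℝ) : ℂ) * I) * omegaW D ((u : ℂ) + ((t : ℝ) : ℂ) * I)‖ ≤
            Mval := by
      intro t ht u hu
      have h := norm_frakk1_omega_le_left_uniform c' hC0 hC x h22x hD3 hp hℓ3 hc8
        (u := u) (by linarith [hu.1]) (by linarith [hu.2]) ht
      rw [hMval, hK]; exact h
    have hmove := Section7aStatements.norm_intJ_sub_intJ_le D (z₁ := -1) (z₂ := -alpha D)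
      (M₁ := Mval) (M₂ := Mval) (by linarith) hF (hside _ (Or.inl rfl)) (hside _ (Or.inr rfl))
    have hI : I2pm c' χ x (-alpha D) - I2pm c' χ x (-1) =
        (Section7aStatements.intJ D (-alpha D) (fun s => frakk1 c' χ x s * omegaW D s) -
          Section7aStatements.intJ D (-1) (fun s => frakk1 c' χ x s * omegaW D s)) /
          (2 * π * I) := by
      rw [I2pm, I2pm, Step8u016.segInt_eq_intJ_div, Step8u016.segInt_eq_intJ_div, sub_div]
    have hnorm2 : ‖(2 : ℂ) * π * I‖ = 2 * π := by
      rw [norm_mul, norm_mul, Complex.norm_I, mul_one, Complex.norm_real, Real.norm_eq_abs,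
        abs_of_pos Real.pi_pos]
      norm_num
    rw [hI, norm_div, hnorm2, div_le_iff₀ (by positivity)]
    calc ‖Section7aStatements.intJ D (-alpha D) (fun s => frakk1 c' χ x s * omegaW D s) -
          Section7aStatements.intJ D (-1) (fun s => frakk1 c' χ x s * omegaW D s)‖
        ≤ (-alpha D - -1) * (Mval + Mval) := hmove
      _ ≤ 1 * (Mval + Mval) := by gcongr; linarith
      _ ≤ Mval * (2 * π) := by nlinarith [Real.pi_gt_three]
  -- summing over `Ψ₁`
  have hsum : ‖(∑ x ∈ finsetOf (PsiOne χ), I2pm c' χ x (-alpha D)) -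
      ∑ x ∈ finsetOf (PsiOne χ), I2pm c' χ x (-1)‖ ≤ (finsetOf (PsiOne χ)).card * Mval := by
    rw [← Finset.sum_sub_distrib]
    calc ‖∑ x ∈ finsetOf (PsiOne χ), (I2pm c' χ x (-alpha D) - I2pm c' χ x (-1))‖
        ≤ ∑ x ∈ finsetOf (PsiOne χ), ‖I2pm c' χ x (-alpha D) - I2pm c' χ x (-1)‖ := norm_sum_le _ _
      _ ≤ ∑ x ∈ finsetOf (PsiOne χ), Mval := Finset.sum_le_sum hper
      _ = (finsetOf (PsiOne χ)).card * Mval := by rw [Finset.sum_const, nsmul_eq_mul]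
  have hcard : ((finsetOf (PsiOne χ)).card : ℝ) ≤ 4 * bigP D ^ 2 :=
    (Ded81Edge.card_finsetOf_psiOne_le_frakP χ).trans (hfrakP D hD₂ hℓ1)
  refine hsum.trans ((mul_le_mul_of_nonneg_right hcard hMval0).trans ?_)
  -- the final size estimate: `4P²·Mval ≤ e^{−𝓛¹⁰/16}`
  have hP : bigP D = Real.exp (ell D ^ 9) := rfl
  have hgrowth := growth_le_left (K₀ := 38) hC0.le (by norm_num) hℓ1 (by
    calc 8 * (38 + 57 * C) = Real.sqrt ((8 * (38 + 57 * C)) ^ 2) := by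
          rw [Real.sqrt_sq (by positivity)]
      _ ≤ Real.sqrt (ell D) := Real.sqrt_le_sqrt hℓA)
  -- `4K e² ≤ e^{𝓛⁹}·… `: constants
  have hconst : 4 * K * Real.exp 2 ≤ Real.exp (3 * ell D ^ 9) := by
    have h9 : ell D ≤ ell D ^ 9 := by
      calc ell D = ell D ^ 1 := (pow_one _).symm
        _ ≤ ell D ^ 9 := pow_le_pow_right₀ hℓ1 (by norm_num)
    have h1 : 4 * K ≤ Real.exp (ell D ^ 9) := by
      have : 4 * K ≤ ell D := by linarith
      calc 4 * K ≤ ell D ^ 9 := this.trans h9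
        _ ≤ Real.exp (ell D ^ 9) := by linarith [Real.add_one_le_exp (ell D ^ 9)]
    have h2 : Real.exp 2 ≤ Real.exp (2 * ell D ^ 9) := Real.exp_le_exp.mpr (by nlinarith)
    calc 4 * K * Real.exp 2 ≤ Real.exp (ell D ^ 9) * Real.exp (2 * ell D ^ 9) :=
          mul_le_mul h1 h2 (Real.exp_pos _).le (Real.exp_pos _).le
      _ = Real.exp (3 * ell D ^ 9) := by rw [← Real.exp_add]; ring_nf
  have hexp2 : Real.exp (2 - ell D ^ 10 / 4) = Real.exp 2 * Real.exp (-(ell D ^ 10 / 4)) := by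
    rw [← Real.exp_add]; ring_nf
  calc 4 * bigP D ^ 2 * Mval
      = (4 * K * Real.exp 2) * (bigP D ^ 35 *
          Real.exp (3 * C * ell D ^ 9 * (1 + 9 * Real.log (ell D))) * Real.exp (-(ell D ^ 10 / 4))) := by
        rw [hMval, hexp2]; ring
    _ ≤ Real.exp (3 * ell D ^ 9) * (bigP D ^ 35 *
          Real.exp (3 * C * ell D ^ 9 * (1 + 9 * Real.log (ell D))) * Real.exp (-(ell D ^ 10 / 4))) :=
        mul_le_mul_of_nonneg_right hconst (mul_nonneg (mul_nonneg (pow_nonneg (Real.exp_pos _).le _)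
          (Real.exp_pos _).le) (Real.exp_pos _).le)
    _ = Real.exp (3 * ell D ^ 9 + 35 * ell D ^ 9 + 3 * C * ell D ^ 9 * (1 + 9 * Real.log (ell D)) +
          -(ell D ^ 10 / 4)) := by
        rw [hP, ← Real.exp_nat_mul, ← Real.exp_add, ← Real.exp_add, ← Real.exp_add]; ring_nf
    _ ≤ 1 * Real.exp (-(1 / 16) * ell D ^ 10) := by
        rw [one_mul, Real.exp_le_exp]
        have : 3 * ell D ^ 9 + 35 * ell D ^ 9 + 3 * C * ell D ^ 9 * (1 + 9 * Real.log (ell D)) =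
            (38 + 3 * C) * ell D ^ 9 + 27 * C * ell D ^ 9 * Real.log (ell D) := by ring
        rw [this]
        have h10 : 0 ≤ ell D ^ 10 := by positivity
        linarith

/-- **`Z22:§15.u008` first half (`Typed.Section15A.Step15_u008a`) HOLDS for every `c′`**
(Proposition 2.2 (i) is the tree theorem `Skeleton.prop22i_holds`).
[cite: Zhang2022LandauSiegel, §15 p. 80 (u008), tex L4033] -/
theorem step15_u008a_holds (c' : ℝ) : Step15_u008a c' := step15_u008a_of_prop22i prop22i_holds c'

end Literature.NumberTheory.LFunctions.Zhang2022.Step15u008
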